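import Literature.NumberTheory.Automorphic.ArchGardingDerivationCalculus
import HarnessLib

/-!
# The Casimir operator of a real place commutes with `GL_n(K_∞)` on the Gårding space and is formally symmetric

Topic `NumberTheory/Automorphic`; namespace `Literature.NumberTheory.Automorphic`. Theorems only (no
definition, no named fact). For a strongly continuous representation `τ` of `G_∞ = GL_n(K_∞)`
(`K_∞ = K ⊗_ℚ ℝ = mixedSpace K`) and a REAL place `w` of `K`, with `r = r_w ∈ K_∞` the idempotent of
the factor `K_w = ℝ` (`(Pi.single w 1, 0)`), the **Casimir operator of the place `w`** on Gårding
vectors is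

  `C_w v = Σ_{i,j} τ(E_{ij} ⊗ r) τ(E_{ji} ⊗ r) v`   (`E_{ij} ⊗ r = Matrix.single i j r`),

the image of the Casimir element `Σ E_{ij}E_{ji} ∈ 𝔷(𝔤𝔩_n(ℝ))` of the factor `𝔤𝔩_n(K_w)` (Knapp
(1986), Ch. VIII §3; Jacquet–Shalika (1981), p. 523, "the Casimir element of `𝔷(G)`"). We prove:

* `apply_toArch_placeCasimirReal` — **`C_w` commutes with every `τ(g)`, `g ∈ GL_n(K_∞)`**, on Gårding
  vectors: by `Ad(g)`-covariance (`apply_toArch_archDerivE`) `τ(g) τ(E_{ij} ⊗ r) τ(g)⁻¹ =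
  τ(g (E_{ij} ⊗ r) g⁻¹) = Σ_{k,l} (g_{ki})_w (g⁻¹_{jl})_w τ(E_{kl} ⊗ r)` (only the `w`-components of
  the entries matter since `y r y' = y_w y'_w r`), and `Σ_i (g_{ki})_w (g⁻¹_{il})_w = δ_{kl}` collapses
  the conjugated double sum back to `C_w` (`sum_sum_comp_comp_eq_of_transform`, the abstract
  bookkeeping: a "matrix of operators" transforming by `F ↦ a F b` with `a b = 1` has invariant
  `Σ F_{ij} F_{ji}`);
* `inner_sum_sum_archDerivE_archDerivE_left` — **`C_w` is formally symmetric**: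
  `⟪C_w v, u⟫ = ⟪v, C_w u⟫` for Gårding `v, u` and unitary `τ` (two skew-symmetries,
  `inner_archDerivE_archDerivE_left`, and the reindexing `(i, j) ↦ (j, i)`; stated for any family of
  directions `X_{ij}`).

With Segal's lemma (`ArchGardingSegal`) these give that `C_w` acts by a scalar on the Gårding space of
an irreducible unitary `τ` (`ArchPlaceCasimirScalar`), the input "`E⁺E⁻ ≡ E⁻E⁺ ≡ 0 (mod 𝔍)`" of
Jacquet–Shalika's automatic-continuity argument on the route to the named fact
`Literature.NumberTheory.Automorphic.JacquetShalika1981_archKirillovNorm_le`.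

## References

* A. W. Knapp, *Representation Theory of Semisimple Groups*, Princeton (1986), Ch. VIII §3
  (Casimir operator, `Ad(G)`-invariance) and Ch. III Prop. 3.9 [Knapp1986].
* H. Jacquet, J. A. Shalika, *On Euler products and the classification of automorphic
  representations I*, Amer. J. Math. 103 (1981), §3, proof of Prop. (3.8), p. 523 [JacquetShalikaAJM1981].
-/

noncomputable section

open MeasureTheory Measure NumberField NumberField.mixedEmbedding NumberField.InfinitePlace IsDedekindDomain Set Filter
open scoped MatrixGroups ENNReal NNReal Classical Topology InnerProductSpace

namespace Literature.NumberTheory.Automorphic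

variable {n : ℕ} {K : Type} [Field K] [NumberField K]

attribute [local instance] glInfBorel borelSpace_glInf locallyCompactSpace_glInf secondCountableTopology_glInf

-- as in `ArchGardingWhittaker`
set_option backward.isDefEq.respectTransparency false

/-! ### 1. Abstract bookkeeping: `Σ F_{ij} F_{ji}` is invariant under `F ↦ a F b` with `a b = 1` -/

section Abstract

variable {V : Type*} [AddCommGroup V] [Module ℂ V]

/-- Additive maps preserving a submodule commute with finite sums inside it: deprecated pointer to
the tree lemma `map_finset_sum_of_forall_mem` (`AutomorphicRepsGLSatakeFlathProofs.lean`; the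
submodule is implicit there; librarian dedup-02184, dedup-02436). [folklore] -/
@[deprecated map_finset_sum_of_forall_mem (since := "2026-08-16")]
theorem apply_sum_eq_sum_of_add (G : Submodule ℂ V) (Φ : V → V)
    (hadd : ∀ u ∈ G, ∀ u' ∈ G, Φ (u + u') = Φ u + Φ u') (h0 : Φ 0 = 0)
    {β : Type*} (s : Finset β) (f : β → V) (hf : ∀ x ∈ s, f x ∈ G) :
    Φ (∑ x ∈ s, f x) = ∑ x ∈ s, Φ (f x) :=
  map_finset_sum_of_forall_mem Φ hadd h0 s f hf

/-- Reindexing a sixfold sum: the two outer indices moved inside. [folklore] -/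
theorem sum_sum_sum4_comm {α : Type*} [Fintype α] {M : Type*} [AddCommMonoid M]
    (g : α → α → α → α → α → α → M) :
    ∑ i, ∑ j, ∑ k, ∑ l, ∑ k', ∑ l', g i j k l k' l' = ∑ k, ∑ l, ∑ k', ∑ l', ∑ i, ∑ j, g i j k l k' l' := by
  have key := Finset.sum_comm (s := (Finset.univ : Finset (α × α))) (t := (Finset.univ : Finset (α × α × α × α)))
    (f := fun p q => g p.1 p.2 q.1 q.2.1 q.2.2.1 q.2.2.2)
  simp only [Fintype.sum_prod_type] at key
  exact key

/-- **The invariant `Σ_{ij} F_{ij} F_{ji}` of a matrix of operators.** Let `F_{ij}` (`i, j ≤ n`) be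
operators on a subspace `G` (additive, homogeneous, `G`-preserving) and `T` a linear map preserving `G`
with `T F_{ij} u = Σ_{k,l} a_{ki} b_{jl} F_{kl} (T u)` on `G`, where `Σ_i a_{ki} b_{il} = δ_{kl}`. Then
`T (Σ_{ij} F_{ij} F_{ji} v) = Σ_{ij} F_{ij} F_{ji} (T v)` for `v ∈ G` — the computation behind the
`Ad(G)`-invariance of the Casimir operator (Knapp (1986), Ch. VIII §3). [cite: Knapp1986, Ch. VIII §3] -/
theorem sum_sum_comp_comp_eq_of_transform (G : Submodule ℂ V) {m : ℕ} (F : Fin m → Fin m → V → V) (T : V →ₗ[ℂ] V)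
    (hFmem : ∀ i j, ∀ u ∈ G, F i j u ∈ G)
    (hFadd : ∀ i j, ∀ u ∈ G, ∀ u' ∈ G, F i j (u + u') = F i j u + F i j u')
    (hFsmul : ∀ i j (c : ℂ), ∀ u ∈ G, F i j (c • u) = c • F i j u)
    (hT : ∀ u ∈ G, T u ∈ G)
    (a b : Fin m → Fin m → ℂ) (hab : ∀ k l, ∑ i, a k i * b i l = if k = l then 1 else 0)
    (htrans : ∀ i j, ∀ u ∈ G, T (F i j u) = ∑ k, ∑ l, (a k i * b j l) • F k l (T u))
    {v : V} (hv : v ∈ G) :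
    T (∑ i, ∑ j, F i j (F j i v)) = ∑ i, ∑ j, F i j (F j i (T v)) := by
  have hF0 : ∀ i j, F i j 0 = 0 := fun i j => by
    have h := hFsmul i j 0 0 (Submodule.zero_mem _)
    rwa [zero_smul, zero_smul] at h
  have hFsum : ∀ k l (s : Finset (Fin m)) (f : Fin m → V), (∀ x ∈ s, f x ∈ G) →
      F k l (∑ x ∈ s, f x) = ∑ x ∈ s, F k l (f x) := fun k l s f hf =>
    map_finset_sum_of_forall_mem (F k l) (hFadd k l) (hF0 k l) s f hf
  have hTv : T v ∈ G := hT v hv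
  -- expand `T (F i j (F j i v))`
  have hexp : ∀ i j, T (F i j (F j i v)) =
      ∑ k, ∑ l, ∑ k', ∑ l', ((a k i * b j l) * (a k' j * b i l')) • F k l (F k' l' (T v)) := by
    intro i j
    rw [htrans i j _ (hFmem j i v hv), htrans j i v hv]
    refine Finset.sum_congr rfl fun k _ => Finset.sum_congr rfl fun l _ => ?_
    rw [hFsum k l _ _ fun k' _ => Submodule.sum_mem _ fun l' _ =>
      Submodule.smul_mem _ _ (hFmem k' l' _ hTv), Finset.smul_sum]
    refine Finset.sum_congr rfl fun k' _ => ?_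
    rw [hFsum k l _ _ fun l' _ => Submodule.smul_mem _ _ (hFmem k' l' _ hTv), Finset.smul_sum]
    refine Finset.sum_congr rfl fun l' _ => ?_
    rw [hFsmul k l _ _ (hFmem k' l' _ hTv), smul_smul]
  -- sum over `i, j`, reindex, and collapse with `Σ_i a_{ki} b_{il'} = δ_{kl'}`, `Σ_j a_{k'j} b_{jl} = δ_{k'l}`
  rw [_root_.map_sum]
  simp_rw [_root_.map_sum, hexp]
  rw [sum_sum_sum4_comm]
  simp_rw [← Finset.sum_smul]
  have hcoef : ∀ k l k' l', ∑ i, ∑ j, (a k i * b j l) * (a k' j * b i l') =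
      (if k = l' then 1 else 0) * (if k' = l then 1 else 0) := by
    intro k l k' l'
    rw [← hab k l', ← hab k' l, Finset.sum_mul_sum]
    refine Finset.sum_congr rfl fun i _ => Finset.sum_congr rfl fun j _ => ?_
    ring
  simp_rw [hcoef]
  simp only [ite_mul, one_mul, zero_mul, ite_smul, one_smul, zero_smul]
  simp only [Finset.sum_ite_eq, Finset.sum_ite_eq', Finset.mem_univ, if_true]

end Abstract

/-! ### 2. The idempotent of a real place and conjugates of `E_{ij} ⊗ r` -/

section RealPlace

variable (K) in
omit [NumberField K] in
/-- `y · r_w · y' = y_w y'_w · r_w` in `K_∞` for the idempotent `r_w = (Pi.single w 1, 0)` of a real place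
`w`: only the `w`-components survive. [folklore] -/
theorem mul_realIdem_mul (w : {w : InfinitePlace K // IsReal w}) (y y' : mixedSpace K) :
    y * ((Pi.single w 1, 0) : mixedSpace K) * y' = (y.1 w * y'.1 w) • ((Pi.single w 1, 0) : mixedSpace K) := by
  refine Prod.ext (funext fun w' => ?_) (funext fun w' => ?_)
  · simp only [Prod.fst_mul, Pi.mul_apply, Prod.smul_fst, Pi.smul_apply, smul_eq_mul]
    by_cases h : w' = w
    · subst h; simp
    · simp [Pi.single_eq_of_ne h]
  · simp

/-- `g (E_{ij} ⊗ x) h = Σ_{k,l} E_{kl} ⊗ (g_{ki} x h_{jl})` for matrices over a commutative ring. [folklore] -/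
theorem mul_single_mul_eq_sum {R : Type*} [CommSemiring R] {m : ℕ} (g h : Matrix (Fin m) (Fin m) R)
    (i j : Fin m) (x : R) :
    g * Matrix.single i j x * h = ∑ k, ∑ l, Matrix.single k l (g k i * x * h j l) := by
  have hS : ∀ (a b : Fin m) (c : R) (q p : Fin m), Matrix.single a b c q p = if a = q ∧ b = p then c else 0 :=
    fun a b c q p => rfl
  ext k' l'
  -- left-hand side entry
  have hL : (g * Matrix.single i j x * h) k' l' = g k' i * x * h j l' := by
    rw [Matrix.mul_apply]
    have h1 : ∀ p, (g * Matrix.single i j x) k' p = if j = p then g k' i * x else 0 := by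
      intro p
      rw [Matrix.mul_apply]
      simp_rw [hS, mul_ite, mul_zero]
      by_cases hp : j = p
      · simp_rw [hp, and_true, if_true]
        rw [Finset.sum_ite_eq Finset.univ i (fun q => g k' q * x), if_pos (Finset.mem_univ _)]
      · simp [hp]
    simp_rw [h1, ite_mul, zero_mul]
    rw [Finset.sum_ite_eq Finset.univ j (fun p => g k' i * x * h p l'), if_pos (Finset.mem_univ _)]
  rw [hL, Matrix.sum_apply]
  simp_rw [Matrix.sum_apply, hS]
  have hR : ∀ k : Fin m, (∑ l : Fin m, if k = k' ∧ l = l' then g k i * x * h j l else 0) =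
      if k = k' then g k i * x * h j l' else 0 := by
    intro k
    by_cases hk : k = k'
    · simp_rw [hk, true_and, if_true]
      rw [Finset.sum_ite_eq' Finset.univ l' (fun l => g k' i * x * h j l), if_pos (Finset.mem_univ _)]
    · simp [hk]
  simp_rw [hR]
  rw [Finset.sum_ite_eq' Finset.univ k' (fun k => g k i * x * h j l'), if_pos (Finset.mem_univ _)]

omit [NumberField K] in
/-- **Conjugating `E_{ij} ⊗ r_w`**: `g (E_{ij} ⊗ r_w) g⁻¹ = Σ_{k,l} (g_{ki})_w (g⁻¹_{jl})_w · (E_{kl} ⊗ r_w)`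
(a real linear combination). [folklore] -/
theorem conj_single_realIdem (w : {w : InfinitePlace K // IsReal w}) (g : GL (Fin n) (mixedSpace K)) (i j : Fin n) :
    g.val * Matrix.single i j ((Pi.single w 1, 0) : mixedSpace K) * (g⁻¹).val =
      ∑ k, ∑ l, ((g.val k i).1 w * ((g⁻¹).val j l).1 w) • Matrix.single k l ((Pi.single w 1, 0) : mixedSpace K) := by
  rw [mul_single_mul_eq_sum]
  refine Finset.sum_congr rfl fun k _ => Finset.sum_congr rfl fun l _ => ?_
  rw [Matrix.smul_single, ← mul_realIdem_mul K w]

omit [NumberField K] in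
/-- The `w`-components of `g g⁻¹ = 1`: `Σ_i (g_{ki})_w (g⁻¹_{il})_w = δ_{kl}`. [folklore] -/
theorem sum_fst_mul_fst_inv_eq (w : {w : InfinitePlace K // IsReal w}) (g : GL (Fin n) (mixedSpace K)) (k l : Fin n) :
    ∑ i, (((g.val k i).1 w : ℝ) : ℂ) * ((((g⁻¹).val i l).1 w : ℝ) : ℂ) = if k = l then 1 else 0 := by
  have h1 : (g.val * (g⁻¹).val) k l = (1 : Matrix (Fin n) (Fin n) (mixedSpace K)) k l := by
    rw [← Units.val_mul, mul_inv_cancel, Units.val_one]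
  rw [Matrix.mul_apply] at h1
  have h2 := congrArg (fun y : mixedSpace K => ((y.1 w : ℝ) : ℂ)) h1
  simp only [Prod.fst_sum, Finset.sum_apply, Prod.fst_mul, Pi.mul_apply, Complex.ofReal_sum, Complex.ofReal_mul] at h2
  rw [h2, Matrix.one_apply]
  by_cases hkl : k = l
  · subst hkl; simp
  · rw [if_neg hkl, if_neg hkl]; simp

variable {hcpt : isCompact_glFiniteIntegralLevel n K}
  {E : Type*} [NormedAddCommGroup E] [NormedSpace ℂ E] [CompleteSpace E]
  {τ : ContRepresentation ℂ (AutomorphyDatum.gl n K hcpt).arch.carrier E}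

/-- **Transformation law of the letters `τ(E_{ij} ⊗ r_w)`**: for a Gårding vector `u`,
`τ(g) τ(E_{ij} ⊗ r_w) u = Σ_{k,l} (g_{ki})_w (g⁻¹_{jl})_w · τ(E_{kl} ⊗ r_w) (τ(g) u)`. [cite: Knapp1986, Ch. III §3, Prop. 3.9] -/
theorem apply_toArch_archDerivE_single_realIdem (hτ : τ.IsStronglyContinuous) (w : {w : InfinitePlace K // IsReal w})
    (g : GL (Fin n) (mixedSpace K)) (i j : Fin n) {u : E} (hu : u ∈ archGardingSpace hcpt τ) :
    τ (toArch hcpt g) (archDerivE hcpt τ (Matrix.single i j ((Pi.single w 1, 0) : mixedSpace K)) u) =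
      ∑ k, ∑ l, (((g.val k i).1 w * ((g⁻¹).val j l).1 w : ℝ) : ℂ) •
        archDerivE hcpt τ (Matrix.single k l ((Pi.single w 1, 0) : mixedSpace K)) (τ (toArch hcpt g) u) := by
  have hgu := apply_mem_archGardingSpace hτ (toArch hcpt g) hu
  have hconj := conj_single_realIdem w g i j
  rw [apply_toArch_archDerivE hτ hu g]
  change archDerivE hcpt τ (g.val * Matrix.single i j ((Pi.single w 1, 0) : mixedSpace K) * (g⁻¹).val) (τ (toArch hcpt g) u) = _
  rw [hconj, archDerivE_sum_dir hτ hgu]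
  refine Finset.sum_congr rfl fun k _ => ?_
  rw [archDerivE_sum_smul_dir hτ hgu]

/-- **The Casimir operator of a real place commutes with `GL_n(K_∞)` on Gårding vectors**:
`τ(g) (Σ_{ij} τ(E_{ij} ⊗ r_w) τ(E_{ji} ⊗ r_w) v) = Σ_{ij} τ(E_{ij} ⊗ r_w) τ(E_{ji} ⊗ r_w) (τ(g) v)`
(`Ad(G)`-invariance of the Casimir element of the factor `𝔤𝔩_n(K_w)`, Knapp (1986), Ch. VIII §3).
[cite: Knapp1986, Ch. VIII §3] -/
theorem apply_toArch_placeCasimirReal (hτ : τ.IsStronglyContinuous) (w : {w : InfinitePlace K // IsReal w})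
    (g : GL (Fin n) (mixedSpace K)) {v : E} (hv : v ∈ archGardingSpace hcpt τ) :
    τ (toArch hcpt g) (∑ i, ∑ j, archDerivE hcpt τ (Matrix.single i j ((Pi.single w 1, 0) : mixedSpace K))
        (archDerivE hcpt τ (Matrix.single j i ((Pi.single w 1, 0) : mixedSpace K)) v)) =
      ∑ i, ∑ j, archDerivE hcpt τ (Matrix.single i j ((Pi.single w 1, 0) : mixedSpace K))
        (archDerivE hcpt τ (Matrix.single j i ((Pi.single w 1, 0) : mixedSpace K)) (τ (toArch hcpt g) v)) := by
  set r : mixedSpace K := (Pi.single w 1, 0) with hr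
  have h := sum_sum_comp_comp_eq_of_transform (archGardingSpace hcpt τ)
    (fun i j u => archDerivE hcpt τ (Matrix.single i j r) u) ((τ (toArch hcpt g) : E →L[ℂ] E) : E →ₗ[ℂ] E)
    (fun i j u hu => archDerivE_mem_archGardingSpace hτ _ hu)
    (fun i j u hu u' hu' => by
      have h := archWordDerivE_add hτ hu hu' [Matrix.single i j r]
      simpa only [archWordDerivE_cons, archWordDerivE_nil] using h)
    (fun i j c u hu => by
      have h := archWordDerivE_smul hτ c hu [Matrix.single i j r]
      simpa only [archWordDerivE_cons, archWordDerivE_nil] using h)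
    (fun u hu => apply_mem_archGardingSpace hτ (toArch hcpt g) hu)
    (fun k i => (((g.val k i).1 w : ℝ) : ℂ))
    (fun j l => ((((g⁻¹).val j l).1 w : ℝ) : ℂ))
    (sum_fst_mul_fst_inv_eq w g)
    (fun i j u hu => by
      have h := apply_toArch_archDerivE_single_realIdem hτ w g i j hu
      simp only [Complex.ofReal_mul] at h
      exact h) hv
  exact h

end RealPlace

/-! ### 3. Formal symmetry for unitary `τ` -/

section Symmetric

variable {hcpt : isCompact_glFiniteIntegralLevel n K}
  {E : Type*} [NormedAddCommGroup E] [InnerProductSpace ℂ E] [CompleteSpace E]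
  {τ : ContRepresentation ℂ (AutomorphyDatum.gl n K hcpt).arch.carrier E}

/-- **The place Casimir operator is formally symmetric** for unitary `τ`:
`⟪Σ_{ij} τ(X_{ij}) τ(X_{ji}) v, u⟫ = ⟪v, Σ_{ij} τ(X_{ij}) τ(X_{ji}) u⟫` for Gårding `v, u` and ANY family of
directions `X_{ij}` (two skew-symmetries and the reindexing `(i,j) ↦ (j,i)`). [folklore] -/
theorem inner_sum_sum_archDerivE_archDerivE_left (hτ : τ.IsStronglyContinuous) (hτu : τ.IsUnitary)
    (X : Fin n → Fin n → Matrix (Fin n) (Fin n) (mixedSpace K))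
    {v u : E} (hv : v ∈ archGardingSpace hcpt τ) (hu : u ∈ archGardingSpace hcpt τ) :
    ⟪∑ i, ∑ j, archDerivE hcpt τ (X i j) (archDerivE hcpt τ (X j i) v), u⟫_ℂ =
      ⟪v, ∑ i, ∑ j, archDerivE hcpt τ (X i j) (archDerivE hcpt τ (X j i) u)⟫_ℂ := by
  simp only [sum_inner, inner_sum]
  rw [Finset.sum_comm]
  refine Finset.sum_congr rfl fun a _ => Finset.sum_congr rfl fun b _ => ?_
  exact inner_archDerivE_archDerivE_left hτ hτu hv hu (X b a) (X a b)

end Symmetric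

end Literature.NumberTheory.Automorphic
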